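import Literature.NumberTheory.Sieve.MaynardProductKernelCert3750

/-! # `k = 3750` product-test-function kernel certificate — LITERAL-TABLE variants of the sliced block sums

Continuation of `Literature.NumberTheory.Sieve.MaynardProductKernelCert3750` (same namespace): the interpolated log-weight table is passed to the
heavy kernel facts as ONE packed natural literal `T` (entries of `BT = 88` bits) instead of being recomputed (1088 `KernelLog.logIv` evaluations)
inside the declaration that also evaluates the packed initial vector and the fifteen convolution products — on the project's Lean farm that
combination exceeds the per-check kernel memory ceiling while either part alone fits (prover probes F–I, 2026-08-31).  `FactTab T` certifies the
literal once (every entry `≤ tabFn g`, the clipped `logIv` lower bound); `FactSlL T s L` are the slice facts; `stub_of_factsSL` assembles the registered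
stub `stub_numHoeffdingCert` of the Parity route `MaynardProductExact` (crux `NumLB3749`) verbatim.  No summit is proved here.
[cite: Polymath8b2014, Theorem 6.7 (product test function), numerical instance k = 3750] -/

set_option autoImplicit false
set_option maxRecDepth 4096

open Finset MeasureTheory Set
open Literature.Analysis.Convolution Literature.NumberTheory.Sieve Literature.NumberTheory.Sieve.MaynardTao
open Literature.Analysis.SpecialFunctions.KernelLog (logIv logIv_sound)
open Literature.NumberTheory.Sieve.MaynardTao.ProductKernelCert (tail_arith dconvPow_zero_slot two_pow_pos' le_ceilDiv_mul
  shiftRight_eq_div exp_neg_le_pow cond2_arith eexpr_arith cond1_arith two_pow_160 calc_aux)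

/-! ## Memory-light block sums with the log table passed as a LITERAL (`…L` variants)

Farm probes: a declaration that evaluates the packed initial vector, the fifteen products AND the 1088 `logIv` evaluations of the weight table
exceeds the kernel memory ceiling, while init + all fifteen products alone pass (probe I).  So the table is moved out of the heavy declaration:
it is supplied as one packed natural literal `T` (entries of `BT = 88` bits), certified ONCE by the cheap fact `FactTab T` (every entry is `≤ tabFn g`,
the clipped `logIv` lower bound), and the slice facts `FactSlL T s L` read their weights from `T`. -/

namespace Literature.NumberTheory.Sieve.MaynardTao.ProductKernelCert3750

/-- number of certified table entries (`g ≤ Jc/GG + 1 = 1023 < NTAB`). [folklore] -/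
def NTAB : ℕ := 1100
/-- read entry `g` of a packed literal table `T` (digit width `BT`). [folklore] -/
def tabDigitL (T g : ℕ) : ℕ := (T >>> (BT * g)) &&& onesBelow BT
/-- the interpolated block weight read from the literal table. [folklore] -/
def ellTL (T i : ℕ) : ℕ :=
  tabDigitL T (Vv i / GG) + (tabDigitL T (Vv i / GG + 1) - tabDigitL T (Vv i / GG)) * (Vv i % GG) / GG
/-- block sums against the literal-table weights (binary splitting, as `nsGo`). [folklore] -/
def nsGoL (T N : ℕ) : ℕ → ℕ → ℕ
  | 0, o => ellTL T o ^ 2 * (N % onesBelow BB)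
  | d + 1, o => nsGoL T (N &&& onesBelow (BB * (WW * 2 ^ d))) d o + nsGoL T (N >>> (BB * (WW * 2 ^ d))) d (o + 2 ^ d)
/-- the slice block sum with literal-table weights. [folklore] -/
def NUMSUMSL (T s : ℕ) : ℕ := nsGoL T (sliceVal s) (eS - Wexp) (sliceOff s / WW)
/-- kernel fact: literal lower bound of a slice block sum, literal table. [folklore] -/
def FactSlL (T s L : ℕ) : Bool := Nat.ble L (NUMSUMSL T s)
/-- table certification loop: entries `g < n` of `T` are below the clipped `logIv` lower bounds `tabFn g`. [folklore] -/
def tabOkGo (T : ℕ) : ℕ → Bool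
  | 0 => true
  | n + 1 => tabOkGo T n && Nat.ble (tabDigitL T n) (tabFn n)
/-- kernel fact: the literal table is certified up to `NTAB`. [folklore] -/
def FactTab (T : ℕ) : Bool := tabOkGo T NTAB

noncomputable section
/-- the certification loop, read off. [cite: Polymath8b2014, Theorem 6.7 (product test function), numerical instance k = 3750] -/
theorem tabOkGo_sound (T : ℕ) : ∀ n, tabOkGo T n = true → ∀ g < n, tabDigitL T g ≤ tabFn g
  | 0, _, g, hg => absurd hg (Nat.not_lt_zero g)
  | n + 1, h, g, hg => by
      rw [tabOkGo, Bool.and_eq_true] at h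
      rcases Nat.lt_succ_iff_lt_or_eq.1 hg with hlt | rfl
      · exact tabOkGo_sound T n h.1 g hlt
      · exact Nat.le_of_ble_eq_true h.2
/-- a certified table entry is below the exact scaled log lower bound at the grid point. [cite: Polymath8b2014, Theorem 6.7 (product test function), numerical instance k = 3750] -/
theorem tabDigitL_le_ellOf {T : ℕ} (hT : FactTab T = true) {g : ℕ} (hg : g < NTAB) : tabDigitL T g ≤ ellOf (g * GG) :=
  (tabOkGo_sound T NTAB hT g hg).trans (by rw [tabFn]; exact min_le_left _ _)
/-- both table indices of a block are certified. [cite: Polymath8b2014, Theorem 6.7 (product test function), numerical instance k = 3750] -/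
theorem grid_lt_NTAB (i : ℕ) : Vv i / GG + 1 < NTAB :=
  lt_of_le_of_lt (Nat.add_le_add_right (Nat.div_le_div_right (min_le_right _ _ : Vv i ≤ Jc)) 1) (by decide)
/-- **the literal-table interpolated weight is sound**: `ellTL T i / 2^80 ≤ log((c + (k−1) V_i h)/c)` (grid point below by monotonicity when the
table step is not increasing, else the chord below the concave function). [cite: Polymath8b2014, Theorem 6.7 (product test function), numerical instance k = 3750] -/
theorem ellTL_sound {T : ℕ} (hT : FactTab T = true) (i : ℕ) :
    0 ≤ (ellTL T i : ℝ) ∧ (ellTL T i : ℝ) / 2 ^ 80 ≤ Real.log ((cR + ((nK : ℝ) + 1) * ((Vv i : ℝ) * hR)) / cR) := by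
  refine ⟨Nat.cast_nonneg _, ?_⟩
  have hGG : 0 < GG := by decide
  have hg1 := grid_lt_NTAB i
  have ha := tabDigitL_le_ellOf hT (lt_trans (Nat.lt_succ_self _) hg1)
  have hb := tabDigitL_le_ellOf hT hg1
  obtain ⟨_, hA⟩ := ellOf_sound (Vv i / GG * GG)
  obtain ⟨_, hB⟩ := ellOf_sound ((Vv i / GG + 1) * GG)
  have hdm : Vv i / GG * GG + Vv i % GG = Vv i := Nat.div_add_mod' (Vv i) GG
  have hr : Vv i % GG < GG := Nat.mod_lt _ hGG
  have hV0 : (0 : ℝ) ≤ ((Vv i / GG * GG : ℕ) : ℝ) := Nat.cast_nonneg _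
  have hV1 : (0 : ℝ) ≤ (((Vv i / GG + 1) * GG : ℕ) : ℝ) := Nat.cast_nonneg _
  by_cases hab : tabDigitL T (Vv i / GG + 1) ≤ tabDigitL T (Vv i / GG)
  · -- the table step is not increasing: use the grid point below (monotonicity)
    have h0 : tabDigitL T (Vv i / GG + 1) - tabDigitL T (Vv i / GG) = 0 := Nat.sub_eq_zero_of_le hab
    have hE : ellTL T i = tabDigitL T (Vv i / GG) := by
      rw [ellTL, h0, Nat.zero_mul, Nat.zero_div, Nat.add_zero]
    have hle : (ellTL T i : ℝ) ≤ (ellOf (Vv i / GG * GG) : ℝ) := by rw [hE]; exact_mod_cast ha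
    have hVle : ((Vv i / GG * GG : ℕ) : ℝ) ≤ (Vv i : ℝ) := by exact_mod_cast Nat.div_mul_le_self _ _
    have h280 : (0 : ℝ) < 2 ^ 80 := pow_pos two_pos 80
    calc (ellTL T i : ℝ) / 2 ^ 80 ≤ (ellOf (Vv i / GG * GG) : ℝ) / 2 ^ 80 := div_le_div_of_nonneg_right hle h280.le
      _ ≤ _ := hA
      _ ≤ _ := logA_mono hV0 hVle
  · -- increasing step: chord below the concave log
    rw [not_le] at hab
    have hcast : ((tabDigitL T (Vv i / GG + 1) - tabDigitL T (Vv i / GG) : ℕ) : ℝ) =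
        (tabDigitL T (Vv i / GG + 1) : ℝ) - (tabDigitL T (Vv i / GG) : ℝ) := Nat.cast_sub hab.le
    have hGr : (0 : ℝ) < (GG : ℝ) := by exact_mod_cast hGG
    set t : ℝ := ((Vv i % GG : ℕ) : ℝ) / (GG : ℝ) with ht
    have ht0 : 0 ≤ t := div_nonneg (Nat.cast_nonneg _) hGr.le
    have ht1 : t ≤ 1 := by
      rw [ht, div_le_one hGr]; exact_mod_cast hr.le
    have hdiv : (((tabDigitL T (Vv i / GG + 1) - tabDigitL T (Vv i / GG)) * (Vv i % GG) / GG : ℕ) : ℝ) ≤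
        ((tabDigitL T (Vv i / GG + 1) : ℝ) - (tabDigitL T (Vv i / GG) : ℝ)) * t := by
      refine le_trans Nat.cast_div_le ?_
      rw [Nat.cast_mul, hcast, ht, mul_div_assoc]
    have hE : (ellTL T i : ℝ) ≤ (tabDigitL T (Vv i / GG) : ℝ) +
        ((tabDigitL T (Vv i / GG + 1) : ℝ) - (tabDigitL T (Vv i / GG) : ℝ)) * t := by
      rw [ellTL, Nat.cast_add]
      linarith [hdiv]
    have hconc := logA_concave hV0 hV1 ht0 ht1
    have harg : (1 - t) * ((Vv i / GG * GG : ℕ) : ℝ) + t * (((Vv i / GG + 1) * GG : ℕ) : ℝ) = (Vv i : ℝ) := by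
      have e1 : (((Vv i / GG + 1) * GG : ℕ) : ℝ) = ((Vv i / GG * GG : ℕ) : ℝ) + (GG : ℝ) := by push_cast; ring
      have e2 : (Vv i : ℝ) = ((Vv i / GG * GG : ℕ) : ℝ) + ((Vv i % GG : ℕ) : ℝ) := by exact_mod_cast hdm.symm
      rw [e1, e2, ht]
      field_simp
      ring
    rw [harg] at hconc
    exact le_trans (div_le_div_of_nonneg_right hE (pow_pos two_pos 80).le)
      (interp_le _ _ _ _ _ _ _ t _ (pow_pos two_pos 80) ht0 ht1 (by exact_mod_cast ha) (by exact_mod_cast hb) hA hB hconc)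

/-- the weight lower bound on block `m / W` (statement as in the template; proof through `ellT_sound`). [cite: Polymath8b2014, Theorem 6.7 (product test function), numerical instance k = 3750] -/
theorem weight_geL {T : ℕ} (hT : FactTab T = true) (m : ℕ) :
    ((ellTL T (m / WW) : ℝ) / 2 ^ 80 / ((nK : ℝ) + 1)) ^ 2 ≤
      (1 / ((nK : ℝ) + 1) *
        Real.log ((cR + ((nK : ℝ) + 1) * min (max (1 - (((m + (nK + 1) : ℕ) : ℝ) * hR - (dP : ℝ) * hR)) 0) TR) / cR)) ^ 2 := by
  have hc := cR_pos; have hh := hR_pos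
  have hn : (0 : ℝ) < (nK : ℝ) + 1 := Nat.cast_add_one_pos nK
  have hVle := Vv_le m
  obtain ⟨h0, h1⟩ := ellTL_sound hT (m / WW)
  have hx : 0 ≤ ((nK : ℝ) + 1) * ((Vv (m / WW) : ℝ) * hR) :=
    mul_nonneg hn.le (mul_nonneg (Nat.cast_nonneg _) hh.le)
  have harg : 0 < (cR + ((nK : ℝ) + 1) * ((Vv (m / WW) : ℝ) * hR)) / cR := div_pos (by linarith) hc
  have hmono : Real.log ((cR + ((nK : ℝ) + 1) * ((Vv (m / WW) : ℝ) * hR)) / cR) ≤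
      Real.log ((cR + ((nK : ℝ) + 1) * min (max (1 - (((m + (nK + 1) : ℕ) : ℝ) * hR - (dP : ℝ) * hR)) 0) TR) / cR) := by
    apply Real.log_le_log harg
    apply div_le_div_of_nonneg_right _ hc.le
    linarith [mul_le_mul_of_nonneg_left hVle hn.le]
  have h2 : (ellTL T (m / WW) : ℝ) / 2 ^ 80 / ((nK : ℝ) + 1) ≤
      1 / ((nK : ℝ) + 1) * Real.log ((cR + ((nK : ℝ) + 1) * min (max (1 - (((m + (nK + 1) : ℕ) : ℝ) * hR - (dP : ℝ) * hR)) 0) TR) / cR) := by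
    rw [div_eq_mul_one_div _ ((nK:ℝ)+1), mul_comm]
    exact mul_le_mul_of_nonneg_left (h1.trans hmono) (one_div_pos.2 hn).le
  have h3 : 0 ≤ (ellTL T (m / WW) : ℝ) / 2 ^ 80 / ((nK : ℝ) + 1) :=
    div_nonneg (div_nonneg h0 (pow_pos two_pos 80).le) hn.le
  exact pow_le_pow_left₀ h3 h2 2

/-! ## Assembly -/
/-- Checker step `weight_geH` of the `k = 3750` kernel certificate (statement and proof adapted from
`Literature.NumberTheory.Sieve.MaynardProductKernelCert4500`, parity-ideate-p3 ROUND-18 template). [cite: Polymath8b2014, Theorem 6.7 (product test function), numerical instance k = 3750] -/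
theorem weight_geHL {T : ℕ} (hT : FactTab T = true) (m : ℕ) :
    ((ellTL T (m / WW) : ℝ) / 2 ^ 80 / ((nK : ℝ) + 1)) ^ 2 ≤
      (∫ u in Ioc 0 (1 - ((((m + (nK + 1) : ℕ) : ℝ)) * hR - (dP : ℝ) * hR)), polymathProfile (nK + 2) cR TR u) ^ 2 := by
  rw [setIntegral_Ioc_polymathProfile two_le_kK cR_pos TR_pos, cast_kK_sub_one]
  exact weight_geL hT m

/-- the binary-splitting block sums are the block sums.
(adapted from `MaynardProductKernelCert4500`). [cite: Polymath8b2014, Theorem 6.7 (product test function), numerical instance k = 3750] -/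
theorem nsGoL_zero (T o : ℕ) (w : ℕ → ℕ) (hs : ∑ t ∈ range WW, w t < 2 ^ BB - 1) :
    nsGoL T (kpack BB WW w) 0 o = ellTL T o ^ 2 * ∑ t ∈ range WW, w t := by
  rw [nsGoL, onesBelow_eq, kpack_mod_eq_sum hs]

/-- Checker step `nsGoL_succ` of the `k = 3750` kernel certificate (statement and proof adapted from
`Literature.NumberTheory.Sieve.MaynardProductKernelCert4500`, parity-ideate-p3 ROUND-18 template). [cite: Polymath8b2014, Theorem 6.7 (product test function), numerical instance k = 3750] -/
theorem nsGoL_succ (T d o : ℕ) (w : ℕ → ℕ) (hd : ∀ j < WW * 2 ^ d, w j < 2 ^ BB) :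
    nsGoL T (kpack BB (WW * 2 ^ d + WW * 2 ^ d) w) (d + 1) o =
      nsGoL T (kpack BB (WW * 2 ^ d) w) d o + nsGoL T (kpack BB (WW * 2 ^ d) (fun i => w (WW * 2 ^ d + i))) d (o + 2 ^ d) := by
  obtain ⟨hlo, hhi⟩ := kpack_low_high (P := WW * 2 ^ d) (w := w) hd
  rw [nsGoL, hlo, hhi]

/-- Checker step `nsGoL_eq` of the `k = 3750` kernel certificate (statement and proof adapted from
`Literature.NumberTheory.Sieve.MaynardProductKernelCert4500`, parity-ideate-p3 ROUND-18 template). [cite: Polymath8b2014, Theorem 6.7 (product test function), numerical instance k = 3750] -/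
theorem nsGoL_eq (T : ℕ) : ∀ (d o : ℕ) (w : ℕ → ℕ), (∀ j < WW * 2 ^ d, w j < 2 ^ BB) →
    (∀ i < 2 ^ d, ∑ t ∈ range WW, w (i * WW + t) < 2 ^ BB - 1) →
    nsGoL T (kpack BB (WW * 2 ^ d) w) d o = ∑ i ∈ range (2 ^ d), ellTL T (o + i) ^ 2 * ∑ t ∈ range WW, w (i * WW + t)
  | 0, o, w, hd, hs => by
      have h1 := hs 0 Nat.one_pos
      simp only [zero_mul, zero_add] at h1
      rw [pow_zero, Finset.sum_range_one, Nat.mul_one, nsGoL_zero T o w h1]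
      simp only [add_zero, zero_mul, zero_add]
  | d + 1, o, w, hd, hs => by
      have hP : WW * 2 ^ (d + 1) = WW * 2 ^ d + WW * 2 ^ d := by rw [pow_succ]; ring
      have hd1 : ∀ j < WW * 2 ^ d, w j < 2 ^ BB := fun j hj => hd j (by rw [hP]; omega)
      have hd2 : ∀ j < WW * 2 ^ d, (fun i => w (WW * 2 ^ d + i)) j < 2 ^ BB := fun j hj => hd _ (by rw [hP]; omega)
      have hidx : ∀ i t : ℕ, WW * 2 ^ d + (i * WW + t) = (2 ^ d + i) * WW + t := fun i t => by ring
      have hs1 : ∀ i < 2 ^ d, ∑ t ∈ range WW, w (i * WW + t) < 2 ^ BB - 1 :=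
        fun i hi => hs i (by rw [pow_succ]; omega)
      have hs2 : ∀ i < 2 ^ d, ∑ t ∈ range WW, (fun i => w (WW * 2 ^ d + i)) (i * WW + t) < 2 ^ BB - 1 := by
        intro i hi
        have := hs (2 ^ d + i) (by rw [pow_succ]; omega)
        simpa only [hidx] using this
      rw [hP, nsGoL_succ T d o w hd1, nsGoL_eq T d o w hd1 hs1, nsGoL_eq T d (o + 2 ^ d) _ hd2 hs2,
        show (2 : ℕ) ^ (d + 1) = 2 ^ d + 2 ^ d by rw [pow_succ]; ring, Finset.sum_range_add, add_right_inj]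
      exact Finset.sum_congr rfl fun i _ => by simp only [hidx, add_assoc]

/-- **the slice block sum (literal table) in block form**. [cite: Polymath8b2014, Theorem 6.7 (product test function), numerical instance k = 3750] -/
theorem NUMSUMSL_eq (T : ℕ) {w : ℕ → ℕ} (hw : NF = kpack BB MM w) (hs : ∑ m ∈ range MM, w m < 2 ^ BB - 1) {s : ℕ} (h8 : s < 8) :
    NUMSUMSL T s = ∑ i ∈ range (2 ^ (eS - Wexp)), ellTL T (2 ^ (eH - Wexp) + s * 2 ^ (eS - Wexp) + i) ^ 2 *
      ∑ t ∈ range WW, w (sliceOff s + (i * WW + t)) := by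
  have hd := digits_lt hs
  have hsl := sliceOff_le h8
  have hd' : ∀ j < WW * 2 ^ (eS - Wexp), (fun i => w (sliceOff s + i)) j < 2 ^ BB := fun j hj =>
    hd _ (by rw [← eS_eqW] at hj; omega)
  have hs' : ∀ i < 2 ^ (eS - Wexp), ∑ t ∈ range WW, (fun i => w (sliceOff s + i)) (i * WW + t) < 2 ^ BB - 1 := by
    intro i hi
    refine lt_of_le_of_lt ?_ hs
    have hsub : ∑ t ∈ range WW, w (sliceOff s + (i * WW + t)) =
        ∑ m ∈ (range WW).map (addLeftEmbedding (sliceOff s + i * WW)), w m := by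
      rw [Finset.sum_map]; exact Finset.sum_congr rfl fun t _ => by simp [add_assoc]
    show ∑ t ∈ range WW, w (sliceOff s + (i * WW + t)) ≤ _
    rw [hsub]
    apply Finset.sum_le_sum_of_subset_of_nonneg
    · intro m hm
      rw [Finset.mem_map] at hm
      obtain ⟨t, ht, rfl⟩ := hm
      rw [Finset.mem_range] at ht ⊢
      simp only [addLeftEmbedding_apply]
      have : i * WW + t < 2 ^ (eS - Wexp) * WW := by nlinarith
      rw [eS_eqW, Nat.mul_comm] at hsl; omega
    · exact fun _ _ _ => Nat.zero_le _
  have e1 : sliceVal s = kpack BB (WW * 2 ^ (eS - Wexp)) (fun i => w (sliceOff s + i)) := by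
    rw [sliceVal, hw, kpack_slice hsl hd, eS_eqW]
  rw [NUMSUMSL, e1, nsGoL_eq T (eS - Wexp) (sliceOff s / WW) (fun i => w (sliceOff s + i)) hd' hs', sliceOff_div]

/-- the eight literal-table slices in one block form over the high half. [cite: Polymath8b2014, Theorem 6.7 (product test function), numerical instance k = 3750] -/
theorem sum_slicesL_eq (T : ℕ) {w : ℕ → ℕ} (hw : NF = kpack BB MM w) (hs : ∑ m ∈ range MM, w m < 2 ^ BB - 1) :
    ∑ s ∈ range 8, NUMSUMSL T s =
      ∑ i ∈ range (2 ^ (eH - Wexp)), ellTL T (2 ^ (eH - Wexp) + i) ^ 2 * ∑ t ∈ range WW, w (2 ^ eH + (i * WW + t)) := by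
  have hK : 2 ^ (eH - Wexp) = 8 * 2 ^ (eS - Wexp) := by decide
  have step : ∀ s ∈ range 8, NUMSUMSL T s = ∑ i ∈ range (2 ^ (eS - Wexp)),
      (fun b => ellTL T (2 ^ (eH - Wexp) + b) ^ 2 * ∑ t ∈ range WW, w (2 ^ eH + (b * WW + t))) (s * 2 ^ (eS - Wexp) + i) := by
    intro s hs8
    rw [Finset.mem_range] at hs8
    rw [NUMSUMSL_eq T hw hs hs8]
    refine Finset.sum_congr rfl fun i _ => ?_
    have e : ∀ t, sliceOff s + (i * WW + t) = 2 ^ eH + ((s * 2 ^ (eS - Wexp) + i) * WW + t) := fun t => by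
      rw [sliceOff_mulW, eH_eqW]; ring
    show _ = ellTL T (2 ^ (eH - Wexp) + (s * 2 ^ (eS - Wexp) + i)) ^ 2 * _
    rw [← add_assoc]
    exact congrArg (fun x => ellTL T (2 ^ (eH - Wexp) + s * 2 ^ (eS - Wexp) + i) ^ 2 * x)
      (Finset.sum_congr rfl fun t _ => by rw [e])
  rw [Finset.sum_congr rfl step]
  have hblk := sum_consecutive_blocks 8 (2 ^ (eS - Wexp))
    (fun b => ellTL T (2 ^ (eH - Wexp) + b) ^ 2 * ∑ t ∈ range WW, w (2 ^ eH + (b * WW + t)))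
  rw [← hK] at hblk
  exact hblk

/-- the same in slot form: `Σ_{m' < 2^19} ellTL((2^19+m')/W)² · w_{2^19+m'}`. [cite: Polymath8b2014, Theorem 6.7 (product test function), numerical instance k = 3750] -/
theorem sum_slicesL_slot (T : ℕ) {w : ℕ → ℕ} (hw : NF = kpack BB MM w) (hs : ∑ m ∈ range MM, w m < 2 ^ BB - 1) :
    ∑ s ∈ range 8, NUMSUMSL T s = ∑ m ∈ range (2 ^ eH), ellTL T ((2 ^ eH + m) / WW) ^ 2 * w (2 ^ eH + m) := by
  have hW : 0 < WW := param_pos.2.2.2.2.2.1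
  rw [sum_slicesL_eq T hw hs, eH_eqW,
    ← sum_range_mul_blockConst (fun j => ellTL T (2 ^ (eH - Wexp) + j) ^ 2) (fun j => w (2 ^ (eH - Wexp) * WW + j)) WW
      (2 ^ (eH - Wexp))]
  refine Finset.sum_congr rfl fun m _ => ?_
  have e : (2 ^ (eH - Wexp) * WW + m) / WW = 2 ^ (eH - Wexp) + m / WW := by
    rw [Nat.mul_comm, Nat.mul_add_div hW]
  rw [e]

/-- **numerator lower bound from the literal-table slices**: for any `SL ≤ Σ_s NUMSUMSL T s` with `T2 ≤ SL`,
`coef·(SL − T2) ≤ NUMER`. [cite: Polymath8b2014, Theorem 6.7 (product test function), numerical instance k = 3750] -/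
theorem numer_geSL (hF : resF.2 = true) (hlog : logOk = true) {T : ℕ} (hT : FactTab T = true) (SL : ℕ)
    (hSL : SL ≤ ∑ s ∈ range 8, NUMSUMSL T s) (hT2le : T2 ≤ SL) :
    m2R ^ (nK + 1) / (((2 ^ LL : ℕ) : ℝ) * 2 ^ 160 * ((nK : ℝ) + 1) ^ 2) * (((SL - T2 : ℕ)) : ℝ) ≤
      ∑ m ∈ range MM, (∫ u in Ioc 0 (1 - ((((m + (nK + 1) : ℕ) : ℝ)) * hR - (dP : ℝ) * hR)),
          polymathProfile (nK + 2) cR TR u) ^ 2 *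
        dconvPow (cellMass (fun t => polymathProfile (nK + 2) cR TR t ^ 2) hR) (nK + 1) m -
      (∫ u in Ioc 0 TR, polymathProfile (nK + 2) cR TR u) ^ 2 *
        ((TR / (cR * (cR + ((nK : ℝ) + 1) * TR))) ^ (nK + 1) *
          Real.exp (-2 * ((Lam : ℝ) * hR) ^ 2 / (((nK : ℝ) + 1) * hR ^ 2))) := by
  have hc := cR_pos; have hh := hR_pos; have hm2 := m2R_pos
  have hS2 : (0:ℝ) < ((2 ^ LL : ℕ) : ℝ) := by exact_mod_cast two_pow_LL_pos
  have hK1 : (0:ℝ) < (nK : ℝ) + 1 := Nat.cast_add_one_pos nK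
  have hG : (0:ℝ) < (2:ℝ) ^ 160 := pow_pos two_pos 160
  have hm2def : TR / (cR * (cR + ((nK : ℝ) + 1) * TR)) = m2R := rfl
  obtain ⟨w, hw, hle, hs⟩ := invF_final hF
  -- the per-slot right-hand side
  set rhs : ℕ → ℝ := fun m => (∫ u in Ioc 0 (1 - ((((m + (nK + 1) : ℕ) : ℝ)) * hR - (dP : ℝ) * hR)),
        polymathProfile (nK + 2) cR TR u) ^ 2 *
      dconvPow (cellMass (fun t => polymathProfile (nK + 2) cR TR t ^ 2) hR) (nK + 1) m with hrhs
  have hrhs0 : ∀ m, 0 ≤ rhs m := fun m =>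
    mul_nonneg (sq_nonneg _) (dconvPow_nonneg (fun j => cellMass_nonneg (fun _ => sq_nonneg _) hR j) _ _)
  have hterm : ∀ m < MM, m2R ^ (nK + 1) / (((2 ^ LL : ℕ) : ℝ) * 2 ^ 160 * ((nK : ℝ) + 1) ^ 2) *
      (((ellTL T (m / WW) ^ 2 * w m : ℕ)) : ℝ) ≤ rhs m := by
    intro m hm
    have h1 := weight_geHL hT m
    have h2 : m2R ^ (nK + 1) * (((w m : ℕ) : ℝ) / ((2 ^ LL : ℕ) : ℝ)) ≤
        dconvPow (cellMass (fun t => polymathProfile (nK + 2) cR TR t ^ 2) hR) (nK + 1) m := by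
      rw [show cellMass (fun t => polymathProfile (nK + 2) cR TR t ^ 2) hR = pp from rfl, dconvPow_pp]
      exact mul_le_mul_of_nonneg_left (hle m hm) (pow_pos hm2 _).le
    have h3 : 0 ≤ ((ellTL T (m / WW) : ℝ) / 2 ^ 80 / ((nK : ℝ) + 1)) ^ 2 := sq_nonneg _
    have h4 : 0 ≤ m2R ^ (nK + 1) * (((w m : ℕ) : ℝ) / ((2 ^ LL : ℕ) : ℝ)) :=
      mul_nonneg (pow_pos hm2 _).le (div_nonneg (Nat.cast_nonneg _) hS2.le)
    calc m2R ^ (nK + 1) / (((2 ^ LL : ℕ) : ℝ) * 2 ^ 160 * ((nK : ℝ) + 1) ^ 2) * (((ellTL T (m / WW) ^ 2 * w m : ℕ)) : ℝ)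
        = ((ellTL T (m / WW) : ℝ) / 2 ^ 80 / ((nK : ℝ) + 1)) ^ 2 *
            (m2R ^ (nK + 1) * (((w m : ℕ) : ℝ) / ((2 ^ LL : ℕ) : ℝ))) := by
          rw [Nat.cast_mul, Nat.cast_pow (ellTL T (m / WW)) 2]
          exact calc_aux _ _ _ _ _ hS2.ne' hK1.ne'
      _ ≤ _ := by rw [hrhs]; exact mul_le_mul h1 h2 h4 (le_trans h3 h1)
  -- summing over the high half and extending to all slots
  have hsum_hi : m2R ^ (nK + 1) / (((2 ^ LL : ℕ) : ℝ) * 2 ^ 160 * ((nK : ℝ) + 1) ^ 2) *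
      ((∑ s ∈ range 8, NUMSUMSL T s : ℕ) : ℝ) ≤ ∑ m ∈ range (2 ^ eH), rhs (2 ^ eH + m) := by
    rw [sum_slicesL_slot T hw hs, Nat.cast_sum, Finset.mul_sum]
    refine Finset.sum_le_sum fun m hm => ?_
    rw [Finset.mem_range] at hm
    have hmm : 2 ^ eH + m < MM := by rw [MM_eqH]; omega
    have := hterm (2 ^ eH + m) hmm
    have e : (2 ^ eH + m) / WW = (2 ^ eH + m) / WW := rfl
    exact this
  have hsplit : ∑ m ∈ range MM, rhs m = ∑ m ∈ range (2 ^ eH), rhs m + ∑ m ∈ range (2 ^ eH), rhs (2 ^ eH + m) := by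
    rw [MM_eqH, Finset.sum_range_add]
  have hlow : 0 ≤ ∑ m ∈ range (2 ^ eH), rhs m := Finset.sum_nonneg fun m _ => hrhs0 m
  have hNUM1 : m2R ^ (nK + 1) / (((2 ^ LL : ℕ) : ℝ) * 2 ^ 160 * ((nK : ℝ) + 1) ^ 2) *
      ((∑ s ∈ range 8, NUMSUMSL T s : ℕ) : ℝ) ≤ ∑ m ∈ range MM, rhs m := by
    rw [hsplit]; linarith [hsum_hi]
  have hcoef : 0 ≤ m2R ^ (nK + 1) / (((2 ^ LL : ℕ) : ℝ) * 2 ^ 160 * ((nK : ℝ) + 1) ^ 2) :=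
    div_nonneg (pow_pos hm2 _).le (mul_pos (mul_pos hS2 hG) (pow_pos hK1 2)).le
  have hSLr : ((SL : ℕ) : ℝ) ≤ ((∑ s ∈ range 8, NUMSUMSL T s : ℕ) : ℝ) := Nat.cast_le.2 hSL
  have htail : (∫ u in Ioc 0 TR, polymathProfile (nK + 2) cR TR u) ^ 2 *
        ((TR / (cR * (cR + ((nK : ℝ) + 1) * TR))) ^ (nK + 1) *
          Real.exp (-2 * ((Lam : ℝ) * hR) ^ 2 / (((nK : ℝ) + 1) * hR ^ 2))) ≤
      m2R ^ (nK + 1) / (((2 ^ LL : ℕ) : ℝ) * 2 ^ 160 * ((nK : ℝ) + 1) ^ 2) * (T2 : ℝ) := by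
    have hT2r := T2_ge hlog
    have hpos : 0 < m2R ^ (nK + 1) := pow_pos hm2 _
    have e1 : (1 / ((nK : ℝ) + 1) * LOGr) ^ 2 * (m2R ^ (nK + 1) *
          Real.exp (-2 * ((Lam : ℝ) * hR) ^ 2 / (((nK : ℝ) + 1) * hR ^ 2))) =
        m2R ^ (nK + 1) / ((2:ℝ) ^ LL * 2 ^ 160 * ((nK : ℝ) + 1) ^ 2) *
          ((2:ℝ) ^ LL * (2 ^ 80 * LOGr) ^ 2 * Real.exp (-2 * ((Lam : ℝ) * hR) ^ 2 / (((nK : ℝ) + 1) * hR ^ 2))) := by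
      field_simp
    rw [GT_eq, hm2def, cast_two_pow_LL, e1]
    rw [cast_two_pow_LL] at hcoef
    exact mul_le_mul_of_nonneg_left hT2r hcoef
  have hNS : (((SL - T2 : ℕ)) : ℝ) = (SL : ℝ) - (T2 : ℝ) := Nat.cast_sub hT2le
  rw [hNS, mul_sub]
  have hmono := mul_le_mul_of_nonneg_left hSLr hcoef
  change _ ≤ ∑ m ∈ range MM, rhs m - _
  linarith [hNUM1, htail, hmono]

/-- **the finite inequality** from the literal-table slice facts. [cite: Polymath8b2014, Theorem 6.7 (product test function), numerical instance k = 3750] -/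
theorem sum_inequalitySL (hF : resF.2 = true) (hlog : logOk = true) {T : ℕ} (hT : FactTab T = true) (SL : ℕ)
    (hSL : SL ≤ ∑ s ∈ range 8, NUMSUMSL T s) (hT2 : Nat.ble T2 SL = true) (hchk : chkN SL T2 = true) :
    (19076 : ℝ) / 10000000000 * ((1000000 : ℝ) / 466771167) ^ 3749 ≤
      ∑ m ∈ range MM,
          (∫ u in Ioc 0 (1 - ((((m + 3749 : ℕ) : ℝ)) * hR - (dP : ℝ) * hR)),
              polymathProfile 3750 ((249 : ℝ) / 2000) ((3 : ℝ) / 4) u) ^ 2 *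
            dconvPow (cellMass (fun t => polymathProfile 3750 ((249 : ℝ) / 2000) ((3 : ℝ) / 4) t ^ 2) hR) 3749 m -
        (∫ u in Ioc 0 ((3 : ℝ) / 4), polymathProfile 3750 ((249 : ℝ) / 2000) ((3 : ℝ) / 4) u) ^ 2 *
          (((1000000 : ℝ) / 466771167) ^ 3749 * Real.exp (-2 * ((Lam : ℝ) * hR) ^ 2 / ((3749 : ℝ) * hR ^ 2))) := by
  have hT2le : T2 ≤ SL := Nat.le_of_ble_eq_true hT2
  have hge := numer_geSL hF hlog hT SL hSL hT2le
  have hNS : (((SL - T2 : ℕ)) : ℝ) = (SL : ℝ) - (T2 : ℝ) := Nat.cast_sub hT2le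
  rw [hNS, m2R_eq', m2R_eq, profile_eq, TR_eq', cast_K1, cast_two_pow_LL, show (nK + 1 : ℕ) = 3749 from rfl] at hge
  have hchk' := chkN_sound SL T2 hchk
  rw [cast_K1] at hchk'
  have hS2 : (0:ℝ) < (2:ℝ) ^ LL := pow_pos two_pos LL
  exact numer_arith 19076 (((1000000 : ℝ) / 466771167) ^ 3749) ((2:ℝ) ^ LL) ((2:ℝ) ^ 160) 3749 (SL : ℝ) (T2 : ℝ) _
    hS2 (pow_pos two_pos 160) (by norm_num) (by positivity) hchk' hge

/-- **the registered stub `stub_numHoeffdingCert` from the literal-table sliced kernel facts**: table certification `FactTab T`, chain checks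
`FactCh`, eight literal slice bounds `FactSlL T s l_s`, the tiny threshold fact `FactFin`, the quarter facts and the side fact.
[cite: Polymath8b2014, Theorem 6.7 (product test function), numerical instance k = 3750] -/
theorem stub_of_factsSL (T : ℕ) (okT : FactTab T = true) (okCh : FactCh = true) (l0 l1 l2 l3 l4 l5 l6 l7 : ℕ)
    (ok0 : FactSlL T 0 l0 = true) (ok1 : FactSlL T 1 l1 = true) (ok2 : FactSlL T 2 l2 = true) (ok3 : FactSlL T 3 l3 = true)
    (ok4 : FactSlL T 4 l4 = true) (ok5 : FactSlL T 5 l5 = true) (ok6 : FactSlL T 6 l6 = true) (ok7 : FactSlL T 7 l7 = true)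
    (okFin : FactFin l0 l1 l2 l3 l4 l5 l6 l7 = true)
    (q0 q1 q2 u0 u1 u2 : ℕ) (okQ0 : FactQ 0 q0 u0 = true)
    (okQ1 : FactQ (0 + 2 ^ 18) q1 u1 = true) (okQ2 : FactQ (0 + 2 ^ (18 + 1)) q2 u2 = true)
    (okS : FactS q0 q1 q2 u0 u1 u2 = true) :
    ∃ (h : ℝ) (Jc M : ℕ) (δ lam : ℝ), 0 < h ∧ (3 : ℝ) / 4 < (Jc : ℝ) * h ∧ 0 ≤ lam ∧
      δ + lam ≤ (3749 : ℝ) * (h -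
        (∫ x in Ici 0, roundErr h x * polymathProfile 3750 ((249 : ℝ) / 2000) ((3 : ℝ) / 4) x ^ 2) /
          ((1000000 : ℝ) / 466771167)) ∧
      (19076 : ℝ) / 10000000000 * ((1000000 : ℝ) / 466771167) ^ 3749 ≤
        ∑ m ∈ range M,
            (∫ u in Ioc 0 (1 - ((((m + 3749 : ℕ) : ℝ)) * h - δ)),
                polymathProfile 3750 ((249 : ℝ) / 2000) ((3 : ℝ) / 4) u) ^ 2 *
              dconvPow (cellMass (fun t => polymathProfile 3750 ((249 : ℝ) / 2000) ((3 : ℝ) / 4) t ^ 2) h) 3749 m -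
          (∫ u in Ioc 0 ((3 : ℝ) / 4), polymathProfile 3750 ((249 : ℝ) / 2000) ((3 : ℝ) / 4) u) ^ 2 *
            (((1000000 : ℝ) / 466771167) ^ 3749 * Real.exp (-2 * lam ^ 2 / ((3749 : ℝ) * h ^ 2))) := by
  rw [FactCh] at okCh
  rw [FactFin, Bool.and_eq_true] at okFin
  obtain ⟨hT2, hchk⟩ := okFin
  obtain ⟨hlog, -, hc2⟩ := sides_of_facts q0 q1 q2 u0 u1 u2 okQ0 okQ1 okQ2 okS
  let L : ℕ → ℕ := fun s => if s = 0 then l0 else if s = 1 then l1 else if s = 2 then l2 else if s = 3 then l3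
    else if s = 4 then l4 else if s = 5 then l5 else if s = 6 then l6 else l7
  have hL : ∀ s < 8, Nat.ble (L s) (NUMSUMSL T s) = true := by
    intro s hs8
    have hcases : s = 0 ∨ s = 1 ∨ s = 2 ∨ s = 3 ∨ s = 4 ∨ s = 5 ∨ s = 6 ∨ s = 7 := by omega
    rcases hcases with rfl | rfl | rfl | rfl | rfl | rfl | rfl | rfl
    exacts [ok0, ok1, ok2, ok3, ok4, ok5, ok6, ok7]
  have hsum : ∑ s ∈ range 8, L s = l0 + l1 + l2 + l3 + l4 + l5 + l6 + l7 := by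
    simp [Finset.sum_range_succ, L]
  have hSL : l0 + l1 + l2 + l3 + l4 + l5 + l6 + l7 ≤ ∑ s ∈ range 8, NUMSUMSL T s := by
    rw [← hsum]
    exact Finset.sum_le_sum fun s hs8 => Nat.le_of_ble_eq_true (hL s (Finset.mem_range.1 hs8))
  have hJ : (3 : ℝ) / 4 < ((Jc + 1 : ℕ) : ℝ) * hR := by rw [← TR_eq']; exact hJcH
  exact ⟨hR, Jc + 1, MM, (dP : ℝ) * hR, (Lam : ℝ) * hR, hR_pos, hJ, mul_nonneg (Nat.cast_nonneg _) hR_pos.le,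
    side_condition hc2, sum_inequalitySL okCh hlog okT _ hSL hT2 hchk⟩

end

end Literature.NumberTheory.Sieve.MaynardTao.ProductKernelCert3750
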